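import Mathlib
import Summits.Ventures.HodgeRepro.Tier3IwasawaLevelQuotient

/-!
# Tier3IwasawaTower — the Iwasawa dictionary R-B.3: the PROJECTIVE SYSTEM of Lang's Theorem 1.1 on the kernel
(`O[X]/(h_{n'}) → O[X]/(h_n)`, `O[Γ_{n'}] → O[Γ_n]`, the map `ε : f ↦ (f mod h_n)_n` is compatible, and so are the
evaluations at a character)

Blind re-derivation cell `pub-hodge-repro`, seat `t3-p3` (Tier 3, T3.2 «(R2) ∧ (R1) — the pinning»; T3.5 Lean item beside
it). Target tree path `lean/Summits/Ventures/HodgeRepro/Tier3IwasawaTower.lean`; imports Mathlib and the cell's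
`Tier3IwasawaLevelQuotient` (t3-p3 g17: `h_n` distinguished, `O⟦X⟧/(h_n) ≅ O[X]/(h_n) ≅ O[Γ_n]`, `f(ζ − 1) = (f mod h_n)(ζ − 1)`)
and through it `Tier3IwasawaFiniteLevel` (t3-p3 g16); theorems only (no definition, instance, notation or macro).

WHAT THIS FILE STATES. Lang, *Cyclotomic Fields I and II* (GTM 121), Ch. 5 §1 Theorem 1.1 (p. 124): «`ε : Λ = ℤ_p⟦X⟧ →
lim ℤ_p[X]/(h_n)` is an isomorphism», `h_n = (1 + X)^{p^n} − 1`, the limit over the reductions `ℤ_p[X]/(h_{n'}) →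
ℤ_p[X]/(h_n)` (`h_n ∣ h_{n'}`), `Γ_n = Γ/Γ^{p^n}` (t3-p4's `R-B3-DICTIONARY.md` §1). `Tier3IwasawaFiniteLevel` and
`Tier3IwasawaLevelQuotient` put the `n`-th TERM on the kernel; this file is the SYSTEM — what makes the terms a projective
system and `ε` a map into its limit:

* `X_add_one_pow_sub_one_dvd`, `X_add_one_pow_sub_one_dvd_of_dvd`, `X_add_one_pow_prime_pow_sub_one_dvd` — `h_m ∣ h_{m'}`
  for `m ∣ m'`, in particular `h_n ∣ h_{n'}` for `n ≤ n'` (the transition maps exist);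
* `weierstrassMod_eq_modByMonic_weierstrassMod`, `weierstrassMod_sub_weierstrassMod_mem_span` — for distinguished
  `h ∣ h'`, the Weierstrass remainder of `f` modulo `h` is the polynomial remainder modulo `h` of its remainder modulo `h'`
  (uniqueness of Weierstrass division against the monic division in `A[X]`);
* `weierstrassMod_X_add_one_pow_prime_pow_sub_one_compat` — **Lang's `ε` on elements**: `f mod h_n = (f mod h_{n'}) %ₘ h_n`
  for `n ≤ n'`, i.e. `(f mod h_n)_n` is a compatible family, an element of `lim O[X]/(h_n)`;
* `toMultiplicative_castHom_ofAdd_one`, `monoidHom_comp_toMultiplicative_castHom_ofAdd_one` — the transition character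
  `Γ_{m'} → Γ_m` (`ZMod m' → ZMod m` for `m ∣ m'`) sends `γ_{m'} ↦ γ_m`, so a character of `Γ_m` pulled back to `Γ_{m'}` has
  the same value `ζ_ν` at the generator;
* `aeval_root_X_add_one_pow_sub_one_of_dvd`, `eval₂_root_X_add_one_pow_sub_one_of_dvd`, `liftAlgHom_root`,
  **`mapDomainAlgHom_comp_liftAlgHom_eq`** — the square `O[X]/(h_{m'}) ≅ O[Γ_{m'}] → O[Γ_m]` = `O[X]/(h_{m'}) → O[X]/(h_m) ≅ O[Γ_m]`
  commutes (both send `1 + X ↦ γ_m`): the group-ring isomorphisms of `Tier3IwasawaFiniteLevel` form a map of projective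
  systems;
* **`lift_comp_castHom_liftAlgHom_mk_weierstrassMod_eq_aeval`** — the evaluations are compatible along the tower: a
  character `ν` of `Γ_n`, pulled back to `Γ_{n'}` and applied to the level-`n'` image of `f ∈ O⟦X⟧`, is `f(ν(γ) − 1)`, the same
  value the level-`n` image gives — «`∫ ν dμ_G = G(ζ_ν − 1)`» does not depend on the level at which it is read.

HONESTY. What stays on the page: the LIMIT itself — that `ε` is injective and surjective onto `lim O[X]/(h_n)` and the
identification `O⟦Γ⟧ = lim O[Γ_n]` (Lang Thm 1.1; Mathlib has no completed group algebra and the limit is not formed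
here), measures ↔ power series (Thm 1.2 / Meas 2), the Katz measure, the interpolation formula, every printed theorem of
R-B. The ring `O` is any adically complete local ring with `p` in its maximal ideal, the value ring `B` any complete
Hausdorff linearly topologised `O`-algebra (the landed chain's context). No verdict / residue / label / row of
route/TIER3.md §3 moves (R-B.3 stays CLOSED on Lang; R-B stays DECLARED). HC_CM is NOT proved by anyone in this repository.
-/

set_option autoImplicit false

open Polynomial
open scoped PowerSeries

namespace Summit.Ventures.HodgeRepro.T3.R2Pinning

section Tower

variable {A : Type*} [CommRing A]

/-- `(X + 1)^m − 1` divides `(X + 1)^{m k} − 1`. -/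
theorem X_add_one_pow_sub_one_dvd (m k : ℕ) :
    ((X + 1) ^ m - 1 : A[X]) ∣ ((X + 1) ^ (m * k) - 1 : A[X]) := by
  rw [pow_mul]
  exact sub_one_dvd_pow_sub_one ((X + 1 : A[X]) ^ m) k

/-- `(X + 1)^m − 1` divides `(X + 1)^{m'} − 1` whenever `m ∣ m'`. -/
theorem X_add_one_pow_sub_one_dvd_of_dvd {m m' : ℕ} (hmm' : m ∣ m') :
    ((X + 1) ^ m - 1 : A[X]) ∣ ((X + 1) ^ m' - 1 : A[X]) := by
  obtain ⟨k, rfl⟩ := hmm'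
  exact X_add_one_pow_sub_one_dvd m k

/-- `h_n ∣ h_{n'}` for `n ≤ n'`: `(X + 1)^{p^n} − 1` divides `(X + 1)^{p^{n'}} − 1`. -/
theorem X_add_one_pow_prime_pow_sub_one_dvd (p : ℕ) {n n' : ℕ} (hle : n ≤ n') :
    ((X + 1) ^ p ^ n - 1 : A[X]) ∣ ((X + 1) ^ p ^ n' - 1 : A[X]) := by
  exact X_add_one_pow_sub_one_dvd_of_dvd (pow_dvd_pow p hle)

end Tower

section Compatible

variable {A : Type*} [CommRing A] [IsLocalRing A] [IsAdicComplete (IsLocalRing.maximalIdeal A) A]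

/-- The Weierstrass remainder of `f` modulo a distinguished `h` is the polynomial remainder modulo `h` of the
Weierstrass remainder modulo any multiple `h'` of `h`. -/
theorem weierstrassMod_eq_modByMonic_weierstrassMod {h h' : A[X]}
    (hd : h.IsDistinguishedAt (IsLocalRing.maximalIdeal A)) (hd' : h'.IsDistinguishedAt (IsLocalRing.maximalIdeal A))
    (hdvd : h ∣ h') (f : A⟦X⟧) :
    PowerSeries.weierstrassMod f (h : A⟦X⟧) = (PowerSeries.weierstrassMod f (h' : A⟦X⟧)) %ₘ h := by
  have h1 : PowerSeries.constantCoeff (1 : A⟦X⟧) ∉ IsLocalRing.maximalIdeal A := by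
    rw [map_one]
    exact (Ideal.ne_top_iff_one _).1 (IsLocalRing.maximalIdeal.isMaximal A).ne_top
  have hg : (h : A⟦X⟧).map (IsLocalRing.residue A) ≠ 0 :=
    hd.map_ne_zero_of_eq_mul (h : A⟦X⟧) 1 h1 (mul_one _).symm
  have hg' : (h' : A⟦X⟧).map (IsLocalRing.residue A) ≠ 0 :=
    hd'.map_ne_zero_of_eq_mul (h' : A⟦X⟧) 1 h1 (mul_one _).symm
  obtain ⟨c, hc⟩ := hdvd
  set r' := PowerSeries.weierstrassMod f (h' : A⟦X⟧) with hr'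
  set q' := PowerSeries.weierstrassDiv f (h' : A⟦X⟧) with hq'
  have hf : f = (h' : A⟦X⟧) * q' + (r' : A⟦X⟧) := PowerSeries.eq_mul_weierstrassDiv_add_weierstrassMod f hg'
  -- order of the image of `h` is its degree
  have hord : ((h : A⟦X⟧).map (Ideal.Quotient.mk (IsLocalRing.maximalIdeal A))).order.toNat = h.natDegree := by
    have := hd.coe_natDegree_eq_order_map (h : A⟦X⟧) 1 h1 (mul_one _).symm
    rw [← this, ENat.toNat_coe]
  -- the division of `f` by `h` with quotient `c q' + (r' /ₘ h)` and remainder `r' %ₘ h`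
  have hmonic : h.Monic := hd.monic
  have hdiv : f.IsWeierstrassDivision (h : A⟦X⟧) ((c : A⟦X⟧) * q' + ((r' /ₘ h : A[X]) : A⟦X⟧)) (r' %ₘ h) := by
    refine ⟨?_, ?_⟩
    · rw [hord, ← Polynomial.degree_eq_natDegree hmonic.ne_zero]
      exact Polynomial.degree_modByMonic_lt r' hmonic
    · have hr'split : (r' : A⟦X⟧) = ((r' %ₘ h : A[X]) : A⟦X⟧) + (h : A⟦X⟧) * ((r' /ₘ h : A[X]) : A⟦X⟧) := by
        rw [← Polynomial.coe_mul, ← Polynomial.coe_add, Polynomial.modByMonic_add_div r' h]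
      rw [hf, hc, hr'split, Polynomial.coe_mul]
      ring
  exact (PowerSeries.IsWeierstrassDivision.unique hg hdiv).2.symm

/-- **Lang's map `ε` is compatible along the tower**: for distinguished `h ∣ h'`, the Weierstrass remainders of `f`
modulo `h'` and modulo `h` agree modulo `h` — `f %ʷ h' − f %ʷ h ∈ (h)` in `A[X]`. -/
theorem weierstrassMod_sub_weierstrassMod_mem_span {h h' : A[X]}
    (hd : h.IsDistinguishedAt (IsLocalRing.maximalIdeal A)) (hd' : h'.IsDistinguishedAt (IsLocalRing.maximalIdeal A))
    (hdvd : h ∣ h') (f : A⟦X⟧) :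
    PowerSeries.weierstrassMod f (h' : A⟦X⟧) - PowerSeries.weierstrassMod f (h : A⟦X⟧) ∈ Ideal.span {h} := by
  rw [weierstrassMod_eq_modByMonic_weierstrassMod hd hd' hdvd f, Ideal.mem_span_singleton']
  refine ⟨PowerSeries.weierstrassMod f (h' : A⟦X⟧) /ₘ h, ?_⟩
  have := Polynomial.modByMonic_add_div (PowerSeries.weierstrassMod f (h' : A⟦X⟧)) h
  linear_combination this

/-- **The projective system of Lang's Theorem 1.1 on elements**: for `n ≤ n'` the level-`n` image `f mod h_n` of a power
series `f` is the level-`n` reduction of its level-`n'` image `f mod h_{n'}` — the family `(f mod h_n)_n` is compatible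
along the tower `… → O[X]/(h_{n'}) → O[X]/(h_n) → …`, i.e. Lang's `ε(f) ∈ lim O[X]/(h_n)`. -/
theorem weierstrassMod_X_add_one_pow_prime_pow_sub_one_compat {p : ℕ} (hp : p.Prime)
    (hpm : (p : A) ∈ IsLocalRing.maximalIdeal A) {n n' : ℕ} (hle : n ≤ n') (f : A⟦X⟧) :
    PowerSeries.weierstrassMod f (((X + 1) ^ p ^ n - 1 : A[X]) : A⟦X⟧) =
      (PowerSeries.weierstrassMod f (((X + 1) ^ p ^ n' - 1 : A[X]) : A⟦X⟧)) %ₘ ((X + 1) ^ p ^ n - 1 : A[X]) :=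
  weierstrassMod_eq_modByMonic_weierstrassMod (isDistinguishedAt_X_add_one_pow_prime_pow_sub_one hp hpm n)
    (isDistinguishedAt_X_add_one_pow_prime_pow_sub_one hp hpm n') (X_add_one_pow_prime_pow_sub_one_dvd p hle) f

end Compatible

/-! ### The group-ring side of the tower: `Γ_{n'} → Γ_n`, `O[Γ_{n'}] → O[Γ_n]`, and the evaluations at a character of `Γ_n` -/

section GroupRingTower

variable {A : Type*} [CommRing A]

/-- `AdjoinRoot.liftAlgHom` sends the root to the chosen root (the `AlgHom` form of `AdjoinRoot.lift_root`). -/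
theorem liftAlgHom_root {R S T : Type*} [CommRing R] [CommRing S] [CommRing T] [Algebra S R] [Algebra S T]
    (p : R[X]) (i : R →ₐ[S] T) (x : T) (h : p.eval₂ i x = 0) :
    AdjoinRoot.liftAlgHom p i x h (AdjoinRoot.root p) = x :=
  AdjoinRoot.lift_root h

/-- The transition character `Γ_{m'} → Γ_m` for `m ∣ m'` (reduction `ZMod m' → ZMod m`, written multiplicatively)
sends the generator to the generator. -/
theorem toMultiplicative_castHom_ofAdd_one {m m' : ℕ} (hmm' : m ∣ m') :
    (AddMonoidHom.toMultiplicative (ZMod.castHom hmm' (ZMod m)).toAddMonoidHom)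
      (Multiplicative.ofAdd (1 : ZMod m')) = Multiplicative.ofAdd (1 : ZMod m) := by
  change Multiplicative.ofAdd ((ZMod.castHom hmm' (ZMod m)) (1 : ZMod m')) = _
  rw [map_one]

/-- A character of `Γ_m` pulled back to `Γ_{m'}` takes the same value at the generator. -/
theorem monoidHom_comp_toMultiplicative_castHom_ofAdd_one {S : Type*} [CommMonoid S] {m m' : ℕ}
    (hmm' : m ∣ m') (ν : Multiplicative (ZMod m) →* S) :
    (ν.comp (AddMonoidHom.toMultiplicative (ZMod.castHom hmm' (ZMod m)).toAddMonoidHom))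
      (Multiplicative.ofAdd (1 : ZMod m')) = ν (Multiplicative.ofAdd (1 : ZMod m)) := by
  rw [MonoidHom.comp_apply, toMultiplicative_castHom_ofAdd_one]

/-- `h_{m'}` vanishes at the root of `h_m` in `O[X]/(h_m)` for `m ∣ m'` (so the transition `O[X]/(h_{m'}) → O[X]/(h_m)`
exists). -/
theorem aeval_root_X_add_one_pow_sub_one_of_dvd {m m' : ℕ} (hmm' : m ∣ m') :
    Polynomial.aeval (AdjoinRoot.root ((X + 1) ^ m - 1 : A[X])) ((X + 1) ^ m' - 1 : A[X]) = 0 := by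
  rw [AdjoinRoot.aeval_eq, AdjoinRoot.mk_eq_zero]
  exact X_add_one_pow_sub_one_dvd_of_dvd hmm'

/-- The same, in the `eval₂` form `AdjoinRoot.liftAlgHom` asks for. -/
theorem eval₂_root_X_add_one_pow_sub_one_of_dvd (A : Type*) [CommRing A] {m m' : ℕ} (hmm' : m ∣ m') :
    Polynomial.eval₂ (Algebra.ofId A (AdjoinRoot ((X + 1) ^ m - 1 : A[X]))) (AdjoinRoot.root ((X + 1) ^ m - 1 : A[X]))
      ((X + 1) ^ m' - 1 : A[X]) = 0 := by
  rw [eval₂_ofId_eq_aeval]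
  exact aeval_root_X_add_one_pow_sub_one_of_dvd hmm'

/-- **The square commutes**: `O[X]/(h_{m k}) ≅ O[Γ_{m k}] → O[Γ_m]` equals `O[X]/(h_{m k}) → O[X]/(h_m) ≅ O[Γ_m]`, both
`O`-algebra maps sending `1 + X ↦ γ_m` (`AdjoinRoot.algHom_ext`). -/
theorem mapDomainAlgHom_comp_liftAlgHom_eq {m m' : ℕ} (hmm' : m ∣ m') :
    (MonoidAlgebra.mapDomainAlgHom A A
        (AddMonoidHom.toMultiplicative (ZMod.castHom hmm' (ZMod m)).toAddMonoidHom)).comp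
      (AdjoinRoot.liftAlgHom ((X + 1) ^ m' - 1)
        (Algebra.ofId A (MonoidAlgebra A (Multiplicative (ZMod m'))))
        (MonoidAlgebra.of A (Multiplicative (ZMod m')) (Multiplicative.ofAdd 1) - 1)
        (eval₂_of_ofAdd_one_sub_one A m')) =
    (AdjoinRoot.liftAlgHom ((X + 1) ^ m - 1) (Algebra.ofId A (MonoidAlgebra A (Multiplicative (ZMod m))))
        (MonoidAlgebra.of A (Multiplicative (ZMod m)) (Multiplicative.ofAdd 1) - 1)
        (eval₂_of_ofAdd_one_sub_one A m)).comp
      (AdjoinRoot.liftAlgHom ((X + 1) ^ m' - 1) (Algebra.ofId A (AdjoinRoot ((X + 1) ^ m - 1 : A[X])))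
        (AdjoinRoot.root ((X + 1) ^ m - 1 : A[X])) (eval₂_root_X_add_one_pow_sub_one_of_dvd A hmm')) := by
  apply AdjoinRoot.algHom_ext
  rw [AlgHom.comp_apply, AlgHom.comp_apply, liftAlgHom_root, liftAlgHom_root, liftAlgHom_root]
  have h1 : (MonoidAlgebra.mapDomainAlgHom A A
      (AddMonoidHom.toMultiplicative (ZMod.castHom hmm' (ZMod m)).toAddMonoidHom))
        (MonoidAlgebra.of A (Multiplicative (ZMod m')) (Multiplicative.ofAdd 1)) =
      MonoidAlgebra.of A (Multiplicative (ZMod m)) (Multiplicative.ofAdd 1) := by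
    rw [MonoidAlgebra.mapDomainAlgHom_apply, MonoidAlgebra.of_apply, MonoidAlgebra.of_apply,
      MonoidAlgebra.mapDomain_single, toMultiplicative_castHom_ofAdd_one]
  rw [map_sub, h1, map_one (MonoidAlgebra.mapDomainAlgHom A A
    (AddMonoidHom.toMultiplicative (ZMod.castHom hmm' (ZMod m)).toAddMonoidHom))]

end GroupRingTower

section TowerEvaluation

variable {A : Type*} [CommRing A] [IsLocalRing A] [IsAdicComplete (IsLocalRing.maximalIdeal A) A]
  [UniformSpace A] [IsUniformAddGroup A] [IsTopologicalRing A]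
variable {B : Type*} [CommRing B] [UniformSpace B] [IsUniformAddGroup B] [T2Space B]
  [CompleteSpace B] [IsTopologicalRing B] [IsLinearTopology B B] [Algebra A B] [ContinuousSMul A B]

/-- **The evaluations are compatible along the tower**: a character `ν` of `Γ_n`, pulled back to `Γ_{n'}` (`n ≤ n'`),
applied to the level-`n'` image of `f ∈ O⟦X⟧` in `O[Γ_{n'}]` is `f(ν(γ) − 1)` — the same value the level-`n` image gives
(`Tier3IwasawaLevelQuotient.lift_liftAlgHom_mk_weierstrassMod_eq_aeval`): Lang's «`∫ ν dμ_G = G(ζ_ν − 1)`» does not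
depend on the level at which it is read. -/
theorem lift_comp_castHom_liftAlgHom_mk_weierstrassMod_eq_aeval {p : ℕ} (hp : p.Prime)
    (hpm : (p : A) ∈ IsLocalRing.maximalIdeal A) {n n' : ℕ} (hle : n ≤ n')
    (ν : Multiplicative (ZMod (p ^ n)) →* B) (hz : PowerSeries.HasEval (ν (Multiplicative.ofAdd 1) - 1))
    (f : A⟦X⟧) :
    (MonoidAlgebra.lift A B (Multiplicative (ZMod (p ^ n')))
        (ν.comp (AddMonoidHom.toMultiplicative
          (ZMod.castHom (pow_dvd_pow p hle) (ZMod (p ^ n))).toAddMonoidHom)))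
      (AdjoinRoot.liftAlgHom ((X + 1) ^ p ^ n' - 1)
        (Algebra.ofId A (MonoidAlgebra A (Multiplicative (ZMod (p ^ n')))))
        (MonoidAlgebra.of A (Multiplicative (ZMod (p ^ n'))) (Multiplicative.ofAdd 1) - 1)
        (eval₂_of_ofAdd_one_sub_one A (p ^ n'))
        (AdjoinRoot.mk _ (PowerSeries.weierstrassMod f (((X + 1) ^ p ^ n' - 1 : A[X]) : A⟦X⟧)))) =
      PowerSeries.aeval hz f := by
  have hval := monoidHom_comp_toMultiplicative_castHom_ofAdd_one (pow_dvd_pow p hle) ν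
  have hz' : PowerSeries.HasEval ((ν.comp (AddMonoidHom.toMultiplicative
      (ZMod.castHom (pow_dvd_pow p hle) (ZMod (p ^ n))).toAddMonoidHom)) (Multiplicative.ofAdd 1) - 1) := by
    rw [hval]; exact hz
  rw [lift_liftAlgHom_mk_weierstrassMod_eq_aeval hp hpm n' _ hz' f]
  have e1 := congrFun (PowerSeries.coe_aeval (R := A) hz') f
  have e2 := congrFun (PowerSeries.coe_aeval (R := A) hz) f
  rw [e1, e2, hval]

end TowerEvaluation

end Summit.Ventures.HodgeRepro.T3.R2Pinning
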